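import Summits.BirchSwinnertonDyer.BirchSwinnertonDyer.Theorems.ResidualThetaTransportAtTwoDefs
import Mathlib.LinearAlgebra.TensorProduct.Tower
import Mathlib.LinearAlgebra.Quotient.Basic
import HarnessLib

/-!
# GLUE clause (6) AT THE PINS: the zeta-quotient conjuncts `hfinH`, `hii`, `hPT` of the one-pair supply — from S3″ (ii_fin), (ii_D′)

Route `ResidualThetaTransportAtTwo` (RTT), crux RSL_g `ResidualSignedLambdaLowerCMAtTwo` (stmt-BirchSwinnertonDyer-22608), line «onepair» (v3d), ASSEMBLY-SPEC-g19
§1 row C6 `SupplyZeta`. Seat `prover-bsd-wall-tp2-p2x-w2` g20 (`--supports`, closes nothing). THEOREMS ONLY. BSD is not proved by any of this.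

The supply witnesses `H := 𝐇¹ = I.H` (an `𝒪`-module through the habitat binders `[Module 𝒪 I.H] [IsScalarTower 𝒪 Λ_𝒪 I.H]`) and
`Z := (span_{Λ_𝒪} {z}).restrictScalars 𝒪`; S3″ speaks of `zetaQuot I z = I.H ⧸ span_{Λ_𝒪} {z}` (quotient by the `Λ_𝒪`-submodule, `𝒪`-module by
`Submodule.Quotient.module'`). The two quotients are the same `𝒪`-module (`Submodule.Quotient.restrictScalarsEquiv`), so `Frac 𝒪 ⊗_𝒪 –` of one is
finite-dimensional iff of the other, with equal dimension (`LinearEquiv.baseChange`):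
* §1 `OnePair.finite_baseChange_quotient_restrictScalars`, `OnePair.finrank_baseChange_quotient_restrictScalars` (generic `A ⊆ R`, `K` an `A`-algebra).
* §2 **`OnePairPins.supplyZeta_of_pins`** — (ii_fin) `Module.Finite (Frac𝒪 ⊗ zetaQuot I z)` and (ii_D′) `λ_𝒪(zetaQuot I z) ≤ λ_𝒪(Sel₀^∨) + e` give
  `Module.Finite (Frac𝒪 ⊗ (I.H ⧸ Z))` ∧ `dim (Frac𝒪 ⊗ (I.H ⧸ Z)) ≤ dim (Frac𝒪 ⊗ Sel₀^∨) + e` ∧ `hPT` (`le_rfl`), i.e. the conjuncts `hfinH`, `hii`, `hPT` of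
  `onePairSupply_of_packages` for `H2 := CharacterModule ↥π.Sel₀`, `Sel₀ := π.Sel₀`.

References: [Kato2004Asterisque] Thm. 12.5 (2) (p. 222), §13.8 (p. 228); [AtiyahMacdonald1969] Ch. 2, Prop. 2.14 and Ex. 2.20 (base change of quotients).
-/

set_option autoImplicit false
-- the Theorems namespace of this sub repeats the summit name by design (D-0017 nested layout)
set_option linter.dupNamespace false

noncomputable section

open scoped TensorProduct

namespace Summit.BirchSwinnertonDyer.BirchSwinnertonDyer.Theorems.OnePair

/-! ## §1 Base change of a quotient does not see `restrictScalars` -/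

section Generic

variable (A K : Type*) [CommRing A] [CommRing K] [Algebra A K] {R : Type*} [Ring R] [SMul A R]
  {M : Type*} [AddCommGroup M] [Module R M] [Module A M] [IsScalarTower A R M] (P : Submodule R M)

/-- **`K ⊗_A (M ⧸ P|_A)` is finite over `K` if `K ⊗_A (M ⧸ P)` is** (`P|_A = P.restrictScalars A`; the quotients are `A`-isomorphic by
`Submodule.Quotient.restrictScalarsEquiv`, base change preserves isomorphisms). [cite: AtiyahMacdonald1969, Ch. 2, Prop. 2.14 (p. 31)] -/
theorem finite_baseChange_quotient_restrictScalars (h : Module.Finite K (K ⊗[A] (M ⧸ P))) :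
    Module.Finite K (K ⊗[A] (M ⧸ P.restrictScalars A)) :=
  Module.Finite.equiv ((Submodule.Quotient.restrictScalarsEquiv A P).baseChange A K _ _).symm

/-- **`dim_K K ⊗_A (M ⧸ P|_A) = dim_K K ⊗_A (M ⧸ P)`.** [cite: AtiyahMacdonald1969, Ch. 2, Prop. 2.14 (p. 31)] -/
theorem finrank_baseChange_quotient_restrictScalars :
    Module.finrank K (K ⊗[A] (M ⧸ P.restrictScalars A)) = Module.finrank K (K ⊗[A] (M ⧸ P)) :=
  LinearEquiv.finrank_eq ((Submodule.Quotient.restrictScalarsEquiv A P).baseChange A K _ _)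

end Generic

/-! ## §2 Clause (6) at the pins -/

open Field NumberField IsDedekindDomain
  Literature.NumberTheory.EllipticCurves Literature.NumberTheory.GaloisRepresentations Literature.NumberTheory.EllipticCurves.GreenbergSelmer

variable {S : Set (PadicAlgCl 2)} {W : WeierstrassCurve ℚ} [W.IsElliptic] {κ : ZpExtension ℚ 2} {γ : absoluteGaloisGroup ℚ}
  {S₀ : Finset (HeightOneSpectrum (𝓞 ℚ))} {n : ℕ} {ρ : FramedGaloisRep ℚ ↥(padicCoeffIntegers S) 2}
  {Θ : ∀ v : HeightOneSpectrum (𝓞 ℚ), ((2 : ℕ) : 𝓞 ℚ) ∈ v.asIdeal → (Cofree ρ ↥(padicCoeffField S) ≃+ (Fin n → ↥(W.geomPrimaryTorsion 2)))}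
  {hΘ : ∀ v hv (δ : absoluteGaloisGroup (v.adicCompletion ℚ)) m i,
    Θ v hv (resGalOfEmb (closureEmb (K := ℚ) (v.adicCompletion ℚ)) δ • m) i = resGalOfEmb (closureEmb (K := ℚ) (v.adicCompletion ℚ)) δ • Θ v hv m i}
  {I : Kato2004.IwasawaH1DataCoeff (FramedGaloisRep.toGaloisRep ρ) 2 κ γ}
  {Sg : AddSubgroup (subgroupH1 κ.kerSubgroup (Cofree ρ ↥(padicCoeffField S)))} [Module ↥(padicCoeffIntegers S) ↥Sg]
  (π : OnePairPins S W κ γ S₀ n ρ Θ hΘ I Sg) [Module (coeffO S) I.H] [IsScalarTower (coeffO S) (IwasawaAlgebraO S) I.H]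

-- base change of the two habitat quotients through `restrictScalarsEquiv`: instance unification sits at the 200k edge (fails at 100k) — guard per ops habit note
set_option maxHeartbeats 400000 in
/-- **GLUE clause (6) AT THE PINS — the zeta-quotient conjuncts of the one-pair supply.** With `Z := (span_{Λ_𝒪} {z}).restrictScalars 𝒪 ≤ 𝐇¹`,
`H2 := Sel₀^∨ = CharacterModule ↥π.Sel₀` and `e : ℕ`: S3″ (ii_fin) `Module.Finite (Frac𝒪 ⊗_𝒪 zetaQuot I z)` and (ii_D′) `λ_𝒪(zetaQuot I z) ≤ λ_𝒪(Sel₀^∨) + e`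
give `hfinH : Module.Finite (Frac𝒪 ⊗_𝒪 (𝐇¹ ⧸ Z))`, `hii : dim (Frac𝒪 ⊗_𝒪 (𝐇¹ ⧸ Z)) ≤ dim (Frac𝒪 ⊗_𝒪 Sel₀^∨) + e` and `hPT : dim (Frac𝒪 ⊗ Sel₀^∨) ≤ dim (Frac𝒪 ⊗ Sel₀^∨)`.
[cite: Kato2004Asterisque, Thm. 12.5 (2) (p. 222), §13.8 (p. 228)] -/
theorem OnePairPins.supplyZeta_of_pins (z : I.H) {e : ℕ}
    (hiifin : Module.Finite (FractionRing (coeffO S)) (TensorProduct (coeffO S) (FractionRing (coeffO S)) (zetaQuot I z)))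
    (hiiD : lamO S (zetaQuot I z) ≤ lamO S (CharacterModule ↥π.Sel₀) + e) :
    Module.Finite (FractionRing (coeffO S)) (TensorProduct (coeffO S) (FractionRing (coeffO S))
        (I.H ⧸ (Submodule.span (IwasawaAlgebraO S) ({z} : Set I.H)).restrictScalars (coeffO S))) ∧
      Module.finrank (FractionRing (coeffO S)) (TensorProduct (coeffO S) (FractionRing (coeffO S))
          (I.H ⧸ (Submodule.span (IwasawaAlgebraO S) ({z} : Set I.H)).restrictScalars (coeffO S))) ≤
        Module.finrank (FractionRing (coeffO S)) (TensorProduct (coeffO S) (FractionRing (coeffO S)) (CharacterModule ↥π.Sel₀)) + e ∧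
      Module.finrank (FractionRing (coeffO S)) (TensorProduct (coeffO S) (FractionRing (coeffO S)) (CharacterModule ↥π.Sel₀)) ≤
        Module.finrank (FractionRing (coeffO S)) (TensorProduct (coeffO S) (FractionRing (coeffO S)) (CharacterModule ↥π.Sel₀)) := by
  refine ⟨finite_baseChange_quotient_restrictScalars (coeffO S) (FractionRing (coeffO S)) _ hiifin, ?_, le_rfl⟩
  rw [finrank_baseChange_quotient_restrictScalars, ← lamO_eq, ← lamO_eq]
  exact hiiD

end Summit.BirchSwinnertonDyer.BirchSwinnertonDyer.Theorems.OnePair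

end
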